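import Literature.Probability.RandomPlanarGeometry.LoopConfigurations
import HarnessLib

/-!
# Extracting close parametrisations from the loop distances

Topic `Literature/Probability/RandomPlanarGeometry`; proofs only. DKKMO's loop distance
`d(γ₁, γ₂)` (`UnbasedLoop.udist`, arXiv:2012.11672v2 eq. (1)) is an infimum of sup distances
over parametrisations; these lemmas turn a strict bound `d < ε` back into explicit
parametrisations: a change of base point `b`, an increasing reparametrisation `φ` of `[0, 1]`
and possibly a time reversal, after which the two loops are within `ε` at EVERY time. This is
the form in which closeness of loop configurations (`LoopConfig.IsClose`) is fed to homotopy
arguments (the straight-line homotopy between the two parametrisations), e.g. in the transfer of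
quad crossings between close loop configurations
(`Literature.Probability.Percolation.dkkmo_crossing_rotation_invariance`).

## References

* H. Duminil-Copin, K. K. Kozlowski, D. Krachun, I. Manolescu, M. Oulamara, *Rotational
  invariance in critical planar lattice models*, arXiv:2012.11672v2, §1.2 eq. (1)
  [arXiv201211672v2].
* M. Aizenman, A. Burchard, Duke Math. J. 99 (1999), §2.1 [AizenmanBurchard1999].
-/

noncomputable section

namespace Literature.Probability.RandomPlanarGeometry

open Set unitInterval

variable {E : Type*} [MetricSpace E]

/-- **From `reparamDist < ε` to a reparametrisation `ε`-close at every time.**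
[cite: AizenmanBurchard1999, §2.1] -/
theorem Curve.exists_reparam_forall_dist_lt {α β : Curve E} {ε : ℝ} (h : Curve.reparamDist α β < ε) :
    ∃ φ : I ≃o I, ∀ t, dist (α t) (β.reparam φ t) < ε := by
  obtain ⟨φ, hφ⟩ := exists_lt_of_ciInf_lt h
  exact ⟨φ, fun t => (ContinuousMap.dist_apply_le_dist t).trans_lt hφ⟩

/-- **From `loopDist < ε` to a base point and a reparametrisation `ε`-close at every time.**
[cite: arXiv201211672v2, §1.2 eq. (1)] -/
theorem Curve.exists_shift_reparam_forall_dist_lt {α β : Curve E} {ε : ℝ}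
    (h : Curve.loopDist α β < ε) :
    ∃ (b : I) (φ : I ≃o I), ∀ t, dist (α t) ((β.shift b).reparam φ t) < ε := by
  obtain ⟨b, hb⟩ := exists_lt_of_ciInf_lt h
  obtain ⟨φ, hφ⟩ := Curve.exists_reparam_forall_dist_lt hb
  exact ⟨b, φ, hφ⟩

/-- **From `d(u, v) < ε` (DKKMO eq. (1)) to explicit parametrisations `ε`-close at every time**:
for based representatives `α`, `β` of the two unbased loops there are an orientation
(`β` or its time reversal), a base point `b` and an increasing reparametrisation `φ` with
`dist (α t) (β'.shift b (φ t)) < ε` for all `t`. [cite: arXiv201211672v2, §1.2 eq. (1)] -/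
theorem Curve.exists_orientation_shift_reparam_forall_dist_lt {α β : Curve E} (hα : α.IsLoop)
    (hβ : β.IsLoop) {ε : ℝ}
    (h : UnbasedLoop.udist (UnbasedLoop.mk (BasedLoop.mk (CurveClass.mk α) (CurveClass.isLoop_mk.2 hα)))
      (UnbasedLoop.mk (BasedLoop.mk (CurveClass.mk β) (CurveClass.isLoop_mk.2 hβ))) < ε) :
    ∃ β' : Curve E, (β' = β ∨ β' = β.reverse) ∧ β'.IsLoop ∧
      ∃ (b : I) (φ : I ≃o I), ∀ t, dist (α t) ((β'.shift b).reparam φ t) < ε := by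
  rw [UnbasedLoop.udist, min_lt_iff] at h
  rcases h with h | h
  · rw [UnbasedLoop.dist_mk_mk, BasedLoop.dist_def, BasedLoop.toCurveClass_mk, BasedLoop.toCurveClass_mk,
      CurveClass.loopDist_mk] at h
    exact ⟨β, Or.inl rfl, hβ, Curve.exists_shift_reparam_forall_dist_lt h⟩
  · rw [UnbasedLoop.reverse_mk, UnbasedLoop.dist_mk_mk, BasedLoop.dist_def, BasedLoop.toCurveClass_reverse,
      BasedLoop.toCurveClass_mk, BasedLoop.toCurveClass_mk, CurveClass.reverse_mk, CurveClass.loopDist_mk] at h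
    exact ⟨β.reverse, Or.inr rfl, (Curve.isLoop_reverse_iff β).2 hβ, Curve.exists_shift_reparam_forall_dist_lt h⟩

end Literature.Probability.RandomPlanarGeometry
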